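import Summits.AtomisticToContinuum.Crystallization.Theorems.FreeSplittingCertificatesStrictSplittingRuleP1FarSiteStar
import Summits.AtomisticToContinuum.Crystallization.Theorems.FreeSplittingCertificatesStrictSplittingRuleP1ReachTable

/-!
# `StrictSplittingRule` (stmt-AtomisticToContinuum-12560): the (S) tail lemma, I — POINTWISE second-order expansion of the radial weights over the star of a far site, and the star moments against its coefficients (P1 interpolant object, part 81)

Route `FreeSplittingCertificates`, crux r3 `StrictSplittingRule` (H12⋆ = `stub_coreJointCoercive`), unit b2b-freesplit-B gen 36.
VALUE = kernel bricks for the (S) TAIL LEMMA (HOME FAR-LEMMA-SPEC §20 (c)/(e)(3); assembled in part 83 `…P1FarSiteTail`).  With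
`x = d + e`, `|d| = r ≥ 20a` (site offset) and `|e|² ≤ 9a²/4` (star radius, part 80), `w = (2⟨d,e⟩ + |e|²)/r² ∈ [−3/20, 1/5]`:
* `inv_pow_four_le_expansion` / `inv_pow_five_ge_expansion` — `(1+w)⁻⁴ ≤ 1 − 4w + 18w²`, `(1+w)⁻⁵ ≥ 1 − 5w` for `w ≥ −1/5`, stated for
  `S ≥ (4/5)R > 0`;
* `abs_fpDot_le_of_star`, `fpSq_add_ge_of_star` — `|⟨d,e⟩| ≤ (3/2)ar`, `|x|² ≥ r² − 3ar ≥ (4/5)r²`, `|x|² ≥ (27a/5)²` (so `χ ≡ 1`);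
* **`cred_pointwise_le`** — `|x|⁻⁸ ≤ r⁻⁸(1 − (8/r²)⟨d,e⟩ + (72/r⁴)⟨d,e⟩² + (18/r⁴)(6ar + 9a²/4)|e|²)`;
* **`rad_pointwise_ge`** — `|x|⁻¹⁰⟨x,z⟩² ≥ r⁻¹⁰(P² + 2Pε − (10/r²)P²δ − (20/r²)Pεδ − (5/r²)P²|e|² − (135/4)(a³/r)|z|²)` (`P = ⟨d,z⟩`,
  `ε = ⟨z,e⟩`, `δ = ⟨d,e⟩`; a polynomial of degree ≤ 2 in `e`);
* `abs_tilt_le` (`|Σ u_k·(√3a²h/240)W(q)_k| ≤ (a³h/12)|u|`), `secondMoment_quad_le` (`dᵀ(VΣ₂)d ≤ V(5a²/36)|d|²`),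
  `abs_secondMoment_mixed_le` (`|zᵀ(VΣ₂)d| ≤ Vσ'|z||d|`), `secondMoment_trace_eq` — the star moments of parts 25/25c against the expansion
  coefficients; `sum3_const_mul`, `sum3_add_const_mul`, `sum33_add_const_mul`, `fpChi_sq_le_one` — bookkeeping.
NOT a proof of H12⋆, NOT summit progress.  [folklore]
-/

noncomputable section

open Set Function Metric MeasureTheory Filter Topology
open scoped BigOperators NNReal ENNReal Classical

namespace Summit.AtomisticToContinuum.Crystallization.Theorems.StrictSplittingRuleBirth

open Literature.MathematicalPhysics.StatisticalMechanics
open Summit.AtomisticToContinuum.Crystallization.Theorems.PalmUnimodularRigidity.LayeredLawsSelectHcp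

/-! ## Two one-variable expansions -/

/-- `(1+w)⁻⁴ ≤ 1 − 4w + 18w²` for `w ≥ −1/5`, in the form `S⁻⁴ ≤ R⁻⁴(1 − 4(S−R)/R + 18((S−R)/R)²)` for `S ≥ (4/5)R > 0`. -/
theorem inv_pow_four_le_expansion {R S : ℝ} (hR : 0 < R) (hS : 4 / 5 * R ≤ S) :
    (S⁻¹) ^ 4 ≤ (R⁻¹) ^ 4 * (1 - 4 * ((S - R) / R) + 18 * ((S - R) / R) ^ 2) := by
  set w := (S - R) / R with hw
  have hw5 : -1 / 5 ≤ w := by rw [hw, le_div_iff₀ hR]; linarith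
  have hSw : S = R * (1 + w) := by rw [hw]; field_simp; ring
  have h1w : 0 < 1 + w := by linarith
  have hS0 : 0 < S := by rw [hSw]; positivity
  -- the polynomial inequality `1 ≤ (1+w)⁴ (1 − 4w + 18w²)`
  have hpoly : 1 ≤ (1 + w) ^ 4 * (1 - 4 * w + 18 * w ^ 2) := by
    have hw' : 0 ≤ w + 1 / 5 := by linarith
    have hq : 0 ≤ 8 + 52 * w + 78 * w ^ 2 := by nlinarith [mul_nonneg hw' hw']
    have hc : 0 ≤ w ^ 2 * (15 + 68 * w) := mul_nonneg (sq_nonneg w) (by linarith)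
    nlinarith [mul_nonneg (sq_nonneg w) hq, mul_nonneg (sq_nonneg w) hc, sq_nonneg (w ^ 3), sq_nonneg (w ^ 2)]
  rw [hSw, mul_inv, mul_pow]
  have h1 : ((1 + w)⁻¹) ^ 4 ≤ 1 - 4 * w + 18 * w ^ 2 := by
    rw [inv_pow, inv_le_iff_one_le_mul₀ (by positivity)]
    linarith [hpoly]
  exact mul_le_mul_of_nonneg_left h1 (by positivity)

/-- `(1+w)⁻⁵ ≥ 1 − 5w` for `w ≥ −1/5`, in the form `R⁻⁵(1 − 5(S−R)/R) ≤ S⁻⁵` for `S ≥ (4/5)R > 0`. -/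
theorem inv_pow_five_ge_expansion {R S : ℝ} (hR : 0 < R) (hS : 4 / 5 * R ≤ S) :
    (R⁻¹) ^ 5 * (1 - 5 * ((S - R) / R)) ≤ (S⁻¹) ^ 5 := by
  set w := (S - R) / R with hw
  have hw5 : -1 / 5 ≤ w := by rw [hw, le_div_iff₀ hR]; linarith
  have hSw : S = R * (1 + w) := by rw [hw]; field_simp; ring
  have h1w : 0 < 1 + w := by linarith
  have hpoly : (1 - 5 * w) * (1 + w) ^ 5 ≤ 1 := by
    have hc : 0 ≤ w ^ 2 * (45 + 24 * w) := mul_nonneg (sq_nonneg w) (by linarith)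
    nlinarith [mul_nonneg (sq_nonneg w) hc, sq_nonneg (w ^ 3), sq_nonneg (w ^ 2), sq_nonneg w,
      mul_nonneg (sq_nonneg w) (show (0:ℝ) ≤ 15 + 40 * w by linarith)]
  rw [hSw, mul_inv, mul_pow]
  have h1 : 1 - 5 * w ≤ ((1 + w)⁻¹) ^ 5 := by
    rw [inv_pow, inv_eq_one_div, le_div_iff₀ (by positivity)]
    exact hpoly
  calc (R⁻¹) ^ 5 * (1 - 5 * w) ≤ (R⁻¹) ^ 5 * ((1 + w)⁻¹) ^ 5 := mul_le_mul_of_nonneg_left h1 (by positivity)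
    _ = (R⁻¹) ^ 5 * ((1 + w)⁻¹) ^ 5 := rfl

/-! ## Pointwise algebra on the star: `x = d + e`, `|e|² ≤ (9/4)a²`, `|d|² = r²`, `r ≥ 20a` -/

/-- `fpSq (d + e) = fpSq d + 2⟪d,e⟫ + fpSq e`. -/
theorem fpSq_add_eq (d e : Fin 3 → ℝ) : fpSq (d + e) = fpSq d + 2 * fpDot d e + fpSq e := by
  simp only [fpSq, fpDot, Pi.add_apply]; ring

/-- Cauchy–Schwarz for the tilt: `|⟪d,e⟫| ≤ (3/2)·a·r` when `|d|² = r²`, `|e|² ≤ (9/4)a²`. -/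
theorem abs_fpDot_le_of_star {d e : Fin 3 → ℝ} {a r : ℝ} (ha : 0 ≤ a) (hr : 0 ≤ r) (hd : fpSq d = r ^ 2)
    (he : fpSq e ≤ 9 / 4 * a ^ 2) : |fpDot d e| ≤ 3 / 2 * a * r := by
  refine abs_le_of_sq_le_sq ?_ (by positivity)
  calc fpDot d e ^ 2 ≤ fpSq d * fpSq e := fpDot_sq_le d e
    _ ≤ r ^ 2 * (9 / 4 * a ^ 2) := by rw [hd]; exact mul_le_mul_of_nonneg_left he (sq_nonneg r)
    _ = (3 / 2 * a * r) ^ 2 := by ring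

/-- On the star of a far site the shifted squared distance stays comparable: `fpSq (d+e) ≥ r² − 3ar ≥ (4/5)r²` and `≥ (27a/5)²`. -/
theorem fpSq_add_ge_of_star {d e : Fin 3 → ℝ} {a r : ℝ} (ha : 0 ≤ a) (hr : 20 * a ≤ r) (hd : fpSq d = r ^ 2)
    (he : fpSq e ≤ 9 / 4 * a ^ 2) :
    r ^ 2 - 3 * a * r ≤ fpSq (d + e) ∧ 4 / 5 * r ^ 2 ≤ fpSq (d + e) ∧ (27 / 5 * a) ^ 2 ≤ fpSq (d + e) := by
  have hr0 : 0 ≤ r := le_trans (by positivity) hr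
  have hde := abs_fpDot_le_of_star ha hr0 hd he
  have h1 : r ^ 2 - 3 * a * r ≤ fpSq (d + e) := by
    rw [fpSq_add_eq, hd]
    have := neg_abs_le (fpDot d e)
    nlinarith [fpSq_nonneg e]
  refine ⟨h1, ?_, ?_⟩
  · nlinarith
  · nlinarith

/-- **CREDIT WEIGHT, POINTWISE**: on the star of a far site, `|x|⁻⁸ ≤ r⁻⁸·U(e)` with
`U(e) = 1 − (8/r²)⟪d,e⟫ + (72/r⁴)⟪d,e⟫² + (18/r⁴)(6ar + 9a²/4)|e|²` (`x = d + e`, `|d| = r ≥ 20a`, `|e|² ≤ 9a²/4`). -/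
theorem cred_pointwise_le {d e : Fin 3 → ℝ} {a r : ℝ} (ha : 0 ≤ a) (hr : 20 * a ≤ r) (hr0 : 0 < r) (hd : fpSq d = r ^ 2)
    (he : fpSq e ≤ 9 / 4 * a ^ 2) :
    ((fpSq (d + e))⁻¹) ^ 4 ≤ ((r ^ 2)⁻¹) ^ 4 *
      (1 - 8 / r ^ 2 * fpDot d e + 72 / (r ^ 2) ^ 2 * fpDot d e ^ 2 + 18 / (r ^ 2) ^ 2 * (6 * a * r + 9 / 4 * a ^ 2) * fpSq e) := by
  obtain ⟨_, hS2, _⟩ := fpSq_add_ge_of_star ha hr hd he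
  have hR : 0 < r ^ 2 := by positivity
  have hexp := inv_pow_four_le_expansion hR hS2
  have hw : (fpSq (d + e) - r ^ 2) / r ^ 2 = (2 * fpDot d e + fpSq e) / r ^ 2 := by rw [fpSq_add_eq, hd]; ring
  rw [hw] at hexp
  refine hexp.trans (mul_le_mul_of_nonneg_left ?_ (by positivity))
  have hδ := abs_fpDot_le_of_star ha hr0.le hd he
  have he0 := fpSq_nonneg e
  have hsq : (2 * fpDot d e + fpSq e) ^ 2 ≤ 4 * fpDot d e ^ 2 + (6 * a * r + 9 / 4 * a ^ 2) * fpSq e := by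
    have h1 : 2 * (2 * fpDot d e) * fpSq e ≤ 4 * (3 / 2 * a * r) * fpSq e := by
      have := le_abs_self (fpDot d e)
      nlinarith
    have h2 : fpSq e ^ 2 ≤ 9 / 4 * a ^ 2 * fpSq e := by nlinarith
    nlinarith
  have h4 : -(4 * ((2 * fpDot d e + fpSq e) / r ^ 2)) ≤ -(8 / r ^ 2 * fpDot d e) := by
    rw [show 4 * ((2 * fpDot d e + fpSq e) / r ^ 2) = 8 / r ^ 2 * fpDot d e + 4 / r ^ 2 * fpSq e by ring]
    have : 0 ≤ 4 / r ^ 2 * fpSq e := by positivity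
    linarith
  have h18 : 18 * ((2 * fpDot d e + fpSq e) / r ^ 2) ^ 2 ≤
      72 / (r ^ 2) ^ 2 * fpDot d e ^ 2 + 18 / (r ^ 2) ^ 2 * (6 * a * r + 9 / 4 * a ^ 2) * fpSq e := by
    rw [show 18 * ((2 * fpDot d e + fpSq e) / r ^ 2) ^ 2 = 18 / (r ^ 2) ^ 2 * (2 * fpDot d e + fpSq e) ^ 2 by ring,
      show 72 / (r ^ 2) ^ 2 * fpDot d e ^ 2 + 18 / (r ^ 2) ^ 2 * (6 * a * r + 9 / 4 * a ^ 2) * fpSq e =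
        18 / (r ^ 2) ^ 2 * (4 * fpDot d e ^ 2 + (6 * a * r + 9 / 4 * a ^ 2) * fpSq e) by ring]
    exact mul_le_mul_of_nonneg_left hsq (by positivity)
  linarith

/-- **RADIAL WEIGHT, POINTWISE**: on the star of a far site, `|x|⁻¹⁰⟪x,z⟫² ≥ r⁻¹⁰·L(e)` with
`L(e) = P² + 2Pε − (10/r²)P²δ − (20/r²)P·εδ − (5/r²)P²|e|² − (135/4)(a³/r)|z|²`
(`P = ⟪d,z⟫`, `ε = ⟪z,e⟫`, `δ = ⟪d,e⟫`; from `(1+w)⁻⁵ ≥ 1 − 5w`, dropping the nonnegative `ε²` pool, bounding the cubic junk by Cauchy–Schwarz). -/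
theorem rad_pointwise_ge {d e z : Fin 3 → ℝ} {a r : ℝ} (ha : 0 ≤ a) (hr : 20 * a ≤ r) (hr0 : 0 < r) (hd : fpSq d = r ^ 2)
    (he : fpSq e ≤ 9 / 4 * a ^ 2) :
    ((r ^ 2)⁻¹) ^ 5 * (fpDot d z ^ 2 + 2 * fpDot d z * fpDot z e - 10 / r ^ 2 * fpDot d z ^ 2 * fpDot d e -
        20 / r ^ 2 * fpDot d z * (fpDot z e * fpDot d e) - 5 / r ^ 2 * fpDot d z ^ 2 * fpSq e -
        135 / 4 * (a ^ 3 / r) * fpSq z) ≤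
      ((fpSq (d + e))⁻¹) ^ 5 * fpDot (d + e) z ^ 2 := by
  obtain ⟨_, hS2, _⟩ := fpSq_add_ge_of_star ha hr hd he
  have hR : 0 < r ^ 2 := by positivity
  have hexp := inv_pow_five_ge_expansion hR hS2
  have hw : (fpSq (d + e) - r ^ 2) / r ^ 2 = (2 * fpDot d e + fpSq e) / r ^ 2 := by rw [fpSq_add_eq, hd]; ring
  rw [hw] at hexp
  have hxz : fpDot (d + e) z = fpDot d z + fpDot z e := by simp only [fpDot, Pi.add_apply]; ring
  have step1 : ((r ^ 2)⁻¹) ^ 5 * (1 - 5 * ((2 * fpDot d e + fpSq e) / r ^ 2)) * fpDot (d + e) z ^ 2 ≤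
      ((fpSq (d + e))⁻¹) ^ 5 * fpDot (d + e) z ^ 2 :=
    mul_le_mul_of_nonneg_right hexp (sq_nonneg _)
  -- the algebra: L ≤ (1 − 5w)(P + ε)²
  have key : fpDot d z ^ 2 + 2 * fpDot d z * fpDot z e - 10 / r ^ 2 * fpDot d z ^ 2 * fpDot d e -
        20 / r ^ 2 * fpDot d z * (fpDot z e * fpDot d e) - 5 / r ^ 2 * fpDot d z ^ 2 * fpSq e -
        135 / 4 * (a ^ 3 / r) * fpSq z ≤ (1 - 5 * ((2 * fpDot d e + fpSq e) / r ^ 2)) * fpDot (d + e) z ^ 2 := by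
    rw [hxz]
    set P := fpDot d z with hP
    set ε := fpDot z e with hε
    set δ := fpDot d e with hδdef
    set E := fpSq e with hE
    set Z := fpSq z with hZ
    have hδ : |δ| ≤ 3 / 2 * a * r := abs_fpDot_le_of_star ha hr0.le hd he
    have hE0 : 0 ≤ E := fpSq_nonneg e
    have hZ0 : 0 ≤ Z := fpSq_nonneg z
    -- the ε² pool is nonnegative
    have hpool : 0 ≤ ε ^ 2 * (1 - 10 / r ^ 2 * δ - 5 / r ^ 2 * E) := by
      refine mul_nonneg (sq_nonneg _) ?_
      have h1 : 10 / r ^ 2 * δ ≤ 10 / r ^ 2 * (3 / 2 * a * r) :=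
        mul_le_mul_of_nonneg_left ((le_abs_self δ).trans hδ) (by positivity)
      have h2 : 5 / r ^ 2 * E ≤ 5 / r ^ 2 * (9 / 4 * a ^ 2) := mul_le_mul_of_nonneg_left he (by positivity)
      have h3 : 10 / r ^ 2 * (3 / 2 * a * r) + 5 / r ^ 2 * (9 / 4 * a ^ 2) ≤ 1 := by
        rw [show 10 / r ^ 2 * (3 / 2 * a * r) + 5 / r ^ 2 * (9 / 4 * a ^ 2) = (15 * a * r + 45 / 4 * a ^ 2) / r ^ 2 by ring,
          div_le_one hR]
        nlinarith
      linarith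
    -- the cubic junk: |P ε| ≤ (3/2) a r |z|²
    have hPε : |P * ε| ≤ 3 / 2 * a * r * Z := by
      refine abs_le_of_sq_le_sq ?_ (by positivity)
      have hP2 : P ^ 2 ≤ fpSq d * Z := fpDot_sq_le d z
      have hε2 : ε ^ 2 ≤ Z * E := fpDot_sq_le z e
      calc (P * ε) ^ 2 = P ^ 2 * ε ^ 2 := by ring
        _ ≤ (fpSq d * Z) * (Z * E) := mul_le_mul hP2 hε2 (sq_nonneg _) (by rw [hd]; positivity)
        _ ≤ (r ^ 2 * Z) * (Z * (9 / 4 * a ^ 2)) := by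
            rw [hd]; exact mul_le_mul_of_nonneg_left (mul_le_mul_of_nonneg_left he hZ0) (by positivity)
        _ = (3 / 2 * a * r * Z) ^ 2 := by ring
    have hjunk : -(135 / 4 * (a ^ 3 / r) * Z) ≤ -(10 / r ^ 2 * (P * ε) * E) := by
      have h1 : |10 / r ^ 2 * (P * ε) * E| ≤ 10 / r ^ 2 * (3 / 2 * a * r * Z) * (9 / 4 * a ^ 2) := by
        rw [abs_mul, abs_mul, abs_of_pos (by positivity : (0:ℝ) < 10 / r ^ 2), abs_of_nonneg hE0]
        exact mul_le_mul (mul_le_mul_of_nonneg_left hPε (by positivity)) he hE0 (by positivity)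
      have h2 : 10 / r ^ 2 * (3 / 2 * a * r * Z) * (9 / 4 * a ^ 2) = 135 / 4 * (a ^ 3 / r) * Z := by
        field_simp
        ring
      have := le_abs_self (10 / r ^ 2 * (P * ε) * E)
      rw [h2] at h1
      linarith
    have hexpand : (1 - 5 * ((2 * δ + E) / r ^ 2)) * (P + ε) ^ 2 =
        (P ^ 2 + 2 * P * ε - 10 / r ^ 2 * P ^ 2 * δ - 20 / r ^ 2 * P * (ε * δ) - 5 / r ^ 2 * P ^ 2 * E) +
          ε ^ 2 * (1 - 10 / r ^ 2 * δ - 5 / r ^ 2 * E) + -(10 / r ^ 2 * (P * ε) * E) := by ring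
    rw [hexpand]
    linarith
  calc ((r ^ 2)⁻¹) ^ 5 * (fpDot d z ^ 2 + 2 * fpDot d z * fpDot z e - 10 / r ^ 2 * fpDot d z ^ 2 * fpDot d e -
        20 / r ^ 2 * fpDot d z * (fpDot z e * fpDot d e) - 5 / r ^ 2 * fpDot d z ^ 2 * fpSq e -
        135 / 4 * (a ^ 3 / r) * fpSq z)
      ≤ ((r ^ 2)⁻¹) ^ 5 * ((1 - 5 * ((2 * fpDot d e + fpSq e) / r ^ 2)) * fpDot (d + e) z ^ 2) :=
        mul_le_mul_of_nonneg_left key (by positivity)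
    _ = ((r ^ 2)⁻¹) ^ 5 * (1 - 5 * ((2 * fpDot d e + fpSq e) / r ^ 2)) * fpDot (d + e) z ^ 2 := by ring
    _ ≤ ((fpSq (d + e))⁻¹) ^ 5 * fpDot (d + e) z ^ 2 := step1

/-! ## The moments against the expansion coefficients -/

/-- Entries of the exact second-moment matrix `Σ₂` (part 25c), as a function table. -/
theorem secondMomentMatrix_apply (a h : ℝ) (k l : Fin 3) :
    (!![a ^ 2 / 8, -(√3 / 72) * a ^ 2, 0; -(√3 / 72) * a ^ 2, 7 * a ^ 2 / 72, 0; 0, 0, h ^ 2 / 6] : Matrix (Fin 3) (Fin 3) ℝ) k l =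
      ![![a ^ 2 / 8, -(√3 / 72) * a ^ 2, 0], ![-(√3 / 72) * a ^ 2, 7 * a ^ 2 / 72, 0], ![0, 0, h ^ 2 / 6]] k l := by
  fin_cases k <;> fin_cases l <;> simp

/-- **Tilt bound**: `|Σ_k u_k·(√3a²h/240)W(q)_k| ≤ (a³h/12)·|u|` (`|W| = 20a/√3`, Cauchy–Schwarz; `|u|² = ρ²`). -/
theorem abs_tilt_le {a h : ℝ} (ha : 0 ≤ a) (hh : 0 ≤ h) (q : ℤ × ℤ × ℤ) {u : Fin 3 → ℝ} {ρ : ℝ} (hρ : 0 ≤ ρ)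
    (hu : fpSq u = ρ ^ 2) :
    |∑ k : Fin 3, u k * (√3 * a ^ 2 * h / 240 *
        (if Even q.1 then (![10 * a, -(10 * √3 / 3) * a, 0] : Fin 3 → ℝ) k else (![-(10 * a), 10 * √3 / 3 * a, 0] : Fin 3 → ℝ) k))| ≤
      a ^ 3 * h / 12 * ρ := by
  have h3 : √3 ^ 2 = 3 := Real.sq_sqrt (by norm_num)
  -- the in-plane Cauchy–Schwarz `(3u₀ − √3u₁)² ≤ 12(u₀² + u₁² + u₂²)`
  have hexp : (√3 * u 0 + 3 * u 1) ^ 2 = 3 * u 0 ^ 2 + 6 * √3 * (u 0 * u 1) + 9 * u 1 ^ 2 := by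
    linear_combination (u 0 ^ 2) * h3
  have hexp' : (3 * u 0 - √3 * u 1) ^ 2 = 9 * u 0 ^ 2 - 6 * √3 * (u 0 * u 1) + 3 * u 1 ^ 2 := by
    linear_combination (u 1 ^ 2) * h3
  have hcs : (3 * u 0 - √3 * u 1) ^ 2 ≤ 12 * ρ ^ 2 := by
    have h0 : 0 ≤ (√3 * u 0 + 3 * u 1) ^ 2 := sq_nonneg _
    rw [← hu, fpSq]
    nlinarith [sq_nonneg (u 2)]
  have hb : a ^ 6 * h ^ 2 / 1728 * (3 * u 0 - √3 * u 1) ^ 2 ≤ (a ^ 3 * h / 12 * ρ) ^ 2 := by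
    calc a ^ 6 * h ^ 2 / 1728 * (3 * u 0 - √3 * u 1) ^ 2 ≤ a ^ 6 * h ^ 2 / 1728 * (12 * ρ ^ 2) :=
          mul_le_mul_of_nonneg_left hcs (by positivity)
      _ = (a ^ 3 * h / 12 * ρ) ^ 2 := by ring
  refine abs_le_of_sq_le_sq ?_ (by positivity)
  simp only [Fin.sum_univ_three]
  split_ifs
  · simp only [Matrix.cons_val_zero, Matrix.cons_val_one, Matrix.cons_val_two, Matrix.head_cons, Matrix.tail_cons,
      Nat.succ_eq_add_one, Nat.reduceAdd]
    have hid : (u 0 * (√3 * a ^ 2 * h / 240 * (10 * a)) + u 1 * (√3 * a ^ 2 * h / 240 * (-(10 * √3 / 3) * a)) +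
        u 2 * (√3 * a ^ 2 * h / 240 * 0)) ^ 2 = a ^ 6 * h ^ 2 / 1728 * (3 * u 0 - √3 * u 1) ^ 2 := by
      linear_combination (a ^ 6 * h ^ 2 / 5184 * (3 * u 0 - √3 * u 1) ^ 2) * h3
    rw [hid]; exact hb
  · simp only [Matrix.cons_val_zero, Matrix.cons_val_one, Matrix.cons_val_two, Matrix.head_cons, Matrix.tail_cons,
      Nat.succ_eq_add_one, Nat.reduceAdd]
    have hid : (u 0 * (√3 * a ^ 2 * h / 240 * -(10 * a)) + u 1 * (√3 * a ^ 2 * h / 240 * (10 * √3 / 3 * a)) +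
        u 2 * (√3 * a ^ 2 * h / 240 * 0)) ^ 2 = a ^ 6 * h ^ 2 / 1728 * (3 * u 0 - √3 * u 1) ^ 2 := by
      linear_combination (a ^ 6 * h ^ 2 / 5184 * (3 * u 0 - √3 * u 1) ^ 2) * h3
    rw [hid]; exact hb

/-- **Second moment along `d`**: `dᵀ(V·Σ₂)d ≤ V·(5a²/36)·|d|²` (`Σ₂ ⪯ (5a²/36)I` needs only `h² ≤ 5a²/6`). -/
theorem secondMoment_quad_le {a h : ℝ} (hh : 0 ≤ h) (hha : h ^ 2 ≤ 5 / 6 * a ^ 2) (d : Fin 3 → ℝ) :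
    ∑ k : Fin 3, ∑ l : Fin 3, (d k * d l) * (√3 * a ^ 2 * h / 2 *
        (!![a ^ 2 / 8, -(√3 / 72) * a ^ 2, 0; -(√3 / 72) * a ^ 2, 7 * a ^ 2 / 72, 0; 0, 0, h ^ 2 / 6] : Matrix (Fin 3) (Fin 3) ℝ) k l) ≤
      √3 * a ^ 2 * h / 2 * (5 * a ^ 2 / 36) * fpSq d := by
  have h3 : √3 ^ 2 = 3 := Real.sq_sqrt (by norm_num)
  have hV : 0 ≤ √3 * a ^ 2 * h / 2 := by positivity
  simp only [secondMomentMatrix_apply, Fin.sum_univ_three, fpSq]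
  simp only [Matrix.cons_val_zero, Matrix.cons_val_one, Matrix.cons_val_two, Matrix.head_cons, Matrix.tail_cons,
    Nat.succ_eq_add_one, Nat.reduceAdd]
  have hsq : (d 0 + √3 * d 1) ^ 2 = d 0 ^ 2 + 2 * √3 * (d 0 * d 1) + 3 * d 1 ^ 2 := by
    linear_combination (d 1 ^ 2) * h3
  have h1 : 0 ≤ a ^ 2 * (d 0 ^ 2 + 2 * √3 * (d 0 * d 1) + 3 * d 1 ^ 2) := by rw [← hsq]; positivity
  have h2 : 0 ≤ (5 / 6 * a ^ 2 - h ^ 2) * d 2 ^ 2 := mul_nonneg (sub_nonneg.2 hha) (sq_nonneg _)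
  have key : d 0 * d 0 * (a ^ 2 / 8) + d 0 * d 1 * (-(√3 / 72) * a ^ 2) + d 1 * d 0 * (-(√3 / 72) * a ^ 2) +
      d 1 * d 1 * (7 * a ^ 2 / 72) + d 2 * d 2 * (h ^ 2 / 6) ≤ 5 * a ^ 2 / 36 * (d 0 ^ 2 + d 1 ^ 2 + d 2 ^ 2) := by
    nlinarith [h1, h2]
  nlinarith [mul_le_mul_of_nonneg_left key hV]

/-- **Mixed second moment**: `|zᵀ(V·Σ₂)d| ≤ V·σ'·|z|·|d|` with the entrywise constant `σ' = (1/8 + √3/36 + 7/72)a² + h²/6`. -/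
theorem abs_secondMoment_mixed_le {a h : ℝ} (hh : 0 ≤ h) {z d : Fin 3 → ℝ} {ζ r : ℝ} (hζ : 0 ≤ ζ) (hr : 0 ≤ r)
    (hz : fpSq z = ζ ^ 2) (hd : fpSq d = r ^ 2) :
    |∑ k : Fin 3, ∑ l : Fin 3, (z k * d l) * (√3 * a ^ 2 * h / 2 *
        (!![a ^ 2 / 8, -(√3 / 72) * a ^ 2, 0; -(√3 / 72) * a ^ 2, 7 * a ^ 2 / 72, 0; 0, 0, h ^ 2 / 6] : Matrix (Fin 3) (Fin 3) ℝ) k l)| ≤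
      √3 * a ^ 2 * h / 2 * ((1 / 8 + √3 / 36 + 7 / 72) * a ^ 2 + h ^ 2 / 6) * ζ * r := by
  have h3' : 0 ≤ √3 := Real.sqrt_nonneg 3
  have hV : 0 ≤ √3 * a ^ 2 * h / 2 := by positivity
  have hzk : ∀ k, |z k| ≤ ζ := fun k =>
    abs_le_of_sq_le_sq (by rw [← hz, fpSq]; fin_cases k <;> simp <;> nlinarith [sq_nonneg (z 0), sq_nonneg (z 1), sq_nonneg (z 2)]) hζ
  have hdl : ∀ l, |d l| ≤ r := fun l =>
    abs_le_of_sq_le_sq (by rw [← hd, fpSq]; fin_cases l <;> simp <;> nlinarith [sq_nonneg (d 0), sq_nonneg (d 1), sq_nonneg (d 2)]) hr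
  have hzd : ∀ k l, |z k * d l| ≤ ζ * r := fun k l => by rw [abs_mul]; exact mul_le_mul (hzk k) (hdl l) (abs_nonneg _) hζ
  have hb : ∀ (k l : Fin 3) {c : ℝ}, 0 ≤ c → |z k * d l * c| ≤ ζ * r * c := fun k l c hc => by
    rw [abs_mul, abs_of_nonneg hc]; exact mul_le_mul_of_nonneg_right (hzd k l) hc
  simp only [secondMomentMatrix_apply, Fin.sum_univ_three]
  simp only [Matrix.cons_val_zero, Matrix.cons_val_one, Matrix.cons_val_two, Matrix.head_cons, Matrix.tail_cons,
    Nat.succ_eq_add_one, Nat.reduceAdd, mul_zero, add_zero]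
  have e00 := abs_le.1 (hb 0 0 (c := √3 * a ^ 2 * h / 2 * (a ^ 2 / 8)) (by positivity))
  have e11 := abs_le.1 (hb 1 1 (c := √3 * a ^ 2 * h / 2 * (7 * a ^ 2 / 72)) (by positivity))
  have e22 := abs_le.1 (hb 2 2 (c := √3 * a ^ 2 * h / 2 * (h ^ 2 / 6)) (by positivity))
  -- the off-diagonal coefficient is negative: bound `z k d l · (V·(−(√3/72)a²)) = −(z k d l · V(√3/72)a²)`
  have e01 := abs_le.1 (hb 0 1 (c := √3 * a ^ 2 * h / 2 * (√3 / 72 * a ^ 2)) (by positivity))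
  have e10 := abs_le.1 (hb 1 0 (c := √3 * a ^ 2 * h / 2 * (√3 / 72 * a ^ 2)) (by positivity))
  have r01 : z 0 * d 1 * (√3 * a ^ 2 * h / 2 * (-(√3 / 72) * a ^ 2)) = -(z 0 * d 1 * (√3 * a ^ 2 * h / 2 * (√3 / 72 * a ^ 2))) := by ring
  have r10 : z 1 * d 0 * (√3 * a ^ 2 * h / 2 * (-(√3 / 72) * a ^ 2)) = -(z 1 * d 0 * (√3 * a ^ 2 * h / 2 * (√3 / 72 * a ^ 2))) := by ring
  rw [r01, r10, abs_le]
  constructor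
  · nlinarith [e00.1, e01.2, e10.2, e11.1, e22.1]
  · nlinarith [e00.2, e01.1, e10.1, e11.2, e22.2]

/-- **Trace**: `Σ_{k,l} [k=l]·c·(V·Σ₂)_{kl} = c·V·((2/9)a² + h²/6)`. -/
theorem secondMoment_trace_eq (a h c : ℝ) :
    ∑ k : Fin 3, ∑ l : Fin 3, (if k = l then c else 0) * (√3 * a ^ 2 * h / 2 *
        (!![a ^ 2 / 8, -(√3 / 72) * a ^ 2, 0; -(√3 / 72) * a ^ 2, 7 * a ^ 2 / 72, 0; 0, 0, h ^ 2 / 6] : Matrix (Fin 3) (Fin 3) ℝ) k l) =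
      c * (√3 * a ^ 2 * h / 2) * (2 / 9 * a ^ 2 + h ^ 2 / 6) := by
  simp only [secondMomentMatrix_apply, Fin.sum_univ_three]
  simp only [Matrix.cons_val_zero, Matrix.cons_val_one, Matrix.cons_val_two, Matrix.head_cons, Matrix.tail_cons,
    Nat.succ_eq_add_one, Nat.reduceAdd]
  norm_num
  ring

/-! ## Bookkeeping for coefficient sums -/

/-- `Σ_k (c·u_k)·M_k = c·Σ_k u_k M_k`. -/
theorem sum3_const_mul (c : ℝ) (u M : Fin 3 → ℝ) : ∑ k : Fin 3, (c * u k) * M k = c * ∑ k : Fin 3, u k * M k := by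
  rw [Finset.mul_sum]; exact Finset.sum_congr rfl fun k _ => mul_assoc _ _ _

/-- `Σ_k (c·u_k + c'·v_k)·M_k = c·Σ u M + c'·Σ v M`. -/
theorem sum3_add_const_mul (c c' : ℝ) (u v M : Fin 3 → ℝ) :
    ∑ k : Fin 3, (c * u k + c' * v k) * M k = c * ∑ k : Fin 3, u k * M k + c' * ∑ k : Fin 3, v k * M k := by
  simp only [Finset.mul_sum, ← Finset.sum_add_distrib]
  exact Finset.sum_congr rfl fun k _ => by ring

/-- `Σ_{kl} (c·A_{kl} + c'·B_{kl})·M_{kl} = c·Σ A M + c'·Σ B M`. -/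
theorem sum33_add_const_mul (c c' : ℝ) (A B M : Fin 3 → Fin 3 → ℝ) :
    ∑ k : Fin 3, ∑ l : Fin 3, (c * A k l + c' * B k l) * M k l =
      c * ∑ k : Fin 3, ∑ l : Fin 3, A k l * M k l + c' * ∑ k : Fin 3, ∑ l : Fin 3, B k l * M k l := by
  simp only [Finset.mul_sum, ← Finset.sum_add_distrib]
  exact Finset.sum_congr rfl fun k _ => Finset.sum_congr rfl fun l _ => by ring

/-- `χ² ≤ 1`. -/
theorem fpChi_sq_le_one (S1 S2 : ℝ) (x : Fin 3 → ℝ) : fpChi S1 S2 x ^ 2 ≤ 1 := by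
  have h := abs_fpChi_le_one S1 S2 x
  have h0 := abs_nonneg (fpChi S1 S2 x)
  rw [← sq_abs]
  nlinarith

end Summit.AtomisticToContinuum.Crystallization.Theorems.StrictSplittingRuleBirth

end
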